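import Literature.Combinatorics.StablePolynomials.MultivariateApolarityDisk
import Literature.Combinatorics.StablePolynomials.WeylAlgebraPreservers
import HarnessLib

/-!
# The apolarity form under affine changes of variables (Borcea–Brändén II, §5 Lemma 5.4 for affine `φ`,
# and Theorem 5.6 for `C_1 = ⋯ = C_n` a disc)

J. Borcea, P. Brändén, *The Lee–Yang and Pólya–Schur programs. II.*, Comm. Pure Appl. Math. 62 (2009)
1595–1631 (arXiv:0809.3087), §5:

> **Lemma 5.4.** Let `κ ∈ ℕⁿ`, `a_i,b_i,c_i,d_i ∈ ℂ`, `a_i d_i - b_i c_i = 1`, `i ∈ [n]`, `f, g ∈ ℂ_κ[z_1,…,z_n]`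
> and set `F(z) = Π_i (c_i z_i + d_i)^{κ_i} f(φ_1(z_1),…,φ_n(z_n))`, `G(z) = Π_i (c_i z_i + d_i)^{κ_i}
> g(φ_1(z_1),…,φ_n(z_n))`, `φ_i(ζ) = (a_i ζ + b_i)/(c_i ζ + d_i)`. Then […] `{F,G}_κ = {f,g}_κ`.
>
> **Theorem 5.6.** Let `C_i`, `i ∈ [n]`, be open discs or exterior of discs and let `f, g ∈ ℂ_κ[z_1,…,z_n]`.
> Suppose that (i) `f` is `C_1 × ⋯ × C_n`-stable and `deg_{z_j}(f) = κ_j` whenever `C_j` is the exterior of a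
> disk, and (ii) `g` is `(ℂ ∖ C_1) × ⋯ × (ℂ ∖ C_n)`-stable and `deg_{z_j}(g) = κ_j` whenever `C_j` is a disk.
> Then `{f,g}_κ ≠ 0`. *Proof.* "For `i ∈ [n]` let `Φ_i` be a Möbius transformation […] for which
> `Φ_i(𝔻) = C_i`. By Lemma 1.8 […] `F` is `𝔻`-stable […] `G` is `ℂ ∖ 𝔻`-stable […] so Lemma 5.5 applies and
> by Lemma 5.4 we get `{f,g}_κ = {F,G}_κ ≠ 0`."

This file treats the *affine* changes of variables `z ↦ az + b` (the Möbius transformations with `c_i = 0`,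
the same for every coordinate — the tree's `affineSubst a b`): the form `{f,g}_κ` of
`MultivariateApolarityDisk.lean` is **translation invariant** on `ℂ_κ[z] × ℂ_κ[z]`
(`mvApolarForm_affineSubst_one`) and **homogeneous of weight `|κ|` under dilations**
(`mvApolarForm_affineSubst_zero`: `{f(az), g(az)}_κ = a^{|κ|} {f,g}_κ`; with the unimodular normalisation
`d = a^{-1}` of Lemma 5.4 this is the printed invariance up to the factor `d^{2|κ|}·a^{|κ|}`), and deduces
**Theorem 5.6 for `C_1 = ⋯ = C_n = {|z - c| < r}`** from Lemma 5.5 (`BorceaBranden_apolarity_disk`).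

Translation invariance is proved through the differential polynomial
`W(f,g) = Σ_{α ≤ κ} (-1)^{|α|} ∂^α f · ∂^{κ-α} g` (so that `{f,g}_κ = W(f,g)(0)` and
`W(f(·+b), g(·+b)) = W(f,g)(· + b)`): for `f, g ∈ ℂ_κ[z]` every `∂_i W(f,g)` telescopes to `0`, hence `W(f,g)`
is constant.

-- TODO(general form): Lemma 5.4 for genuine Möbius transformations (`c_i ≠ 0`) and distinct `φ_i`, and
-- Theorem 5.6 for distinct / non-convex `C_i`, loc. cit.

## Main results (namespace `Literature.Combinatorics.StablePolynomials`)

* `pderiv_mixedPderiv`, `eval_zero_mixedPderiv` (`∂^α f(0) = α! a_α`), `apolarW`, `eval_zero_apolarW`,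
  `pderiv_apolarW_eq_zero`, `eq_C_of_forall_pderiv_eq_zero`, `pderiv_affineSubst_one`,
  `mixedPderiv_affineSubst_one`, `coeff_affineSubst_zero`.
* **`mvApolarForm_affineSubst_one`**, **`mvApolarForm_affineSubst_zero`**, `mvApolarForm_affineSubst`.
* **`BorceaBranden_apolarity_ball`** — Theorem 5.6 for `C_1 = ⋯ = C_n` an open disc.

## References

* [BorceaBranden2009II] J. Borcea, P. Brändén, Comm. Pure Appl. Math. 62 (2009) 1595–1631, §5 Lemma 5.4,
  Lemma 5.5, Thm. 5.6.
-/

noncomputable section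

open MvPolynomial Finset

namespace Literature.Combinatorics.StablePolynomials

variable {τ : Type*} [Fintype τ] [DecidableEq τ]

/-! ## §1 Mixed derivatives: one more `∂_i`, and the value at `0` -/

section Mixed

/-- `(s)_{α + e_i} = (s)_α · (s_i - α_i)`. [cite: BorceaBranden2009, §5 (the falling factorials `(β)_α`)] -/
theorem multiDescFactorial_update_succ (s α : τ → ℕ) (i : τ) :
    multiDescFactorial s (Function.update α i (α i + 1)) = multiDescFactorial s α * (s i - α i) := by
  rw [multiDescFactorial, multiDescFactorial, ← Finset.mul_prod_erase _ _ (Finset.mem_univ i),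
    ← Finset.mul_prod_erase (Finset.univ : Finset τ) (fun j => (s j).descFactorial (α j)) (Finset.mem_univ i),
    Function.update_self, Nat.descFactorial_succ, Finset.prod_congr rfl fun j hj =>
      by rw [Function.update_of_ne (Finset.ne_of_mem_erase hj)]]
  ring

/-- **`∂_i ∂^α = ∂^{α + e_i}`.** [cite: BorceaBranden2009II, §5 (the derivatives `f^{(α)}`) and §7 (the
operators `∂^α`)] -/
theorem pderiv_mixedPderiv (i : τ) (α : τ → ℕ) (f : MvPolynomial τ ℂ) :
    pderiv i (mixedPderiv α f) = mixedPderiv (Function.update α i (α i + 1)) f := by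
  induction f using MvPolynomial.induction_on' with
  | monomial s c =>
    rw [mixedPderiv_monomial, mixedPderiv_monomial, Derivation.map_smul, pderiv_monomial,
      multiDescFactorial_update_succ, Nat.cast_mul, Finsupp.tsub_apply, toF_apply,
      show toF (Function.update α i (α i + 1)) = toF α + Finsupp.single i 1 from Finsupp.ext fun j => by
        by_cases hji : j = i
        · subst hji
          rw [toF_apply, Finsupp.add_apply, toF_apply, Function.update_self, Finsupp.single_eq_same]
        · rw [toF_apply, Finsupp.add_apply, toF_apply, Function.update_of_ne hji,
            Finsupp.single_eq_of_ne hji, add_zero],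
      ← tsub_tsub, show monomial (s - toF α - Finsupp.single i 1) (c * ((s i - α i : ℕ) : ℂ)) =
        ((s i - α i : ℕ) : ℂ) • monomial (s - toF α - Finsupp.single i 1) c by
          rw [smul_monomial, smul_eq_mul, mul_comm], smul_smul]
  | add p q hp hq => rw [map_add, map_add, map_add, hp, hq]

/-- **`∂^α f (0) = α! · a_α`** for `f = Σ a_α z^α` (`α! = Π_i α_i!`). [cite: BorceaBranden2009II, §5
(definition of `{f,g}_κ` via `f^{(α)}(0)`)] -/
theorem eval_zero_mixedPderiv (α : τ → ℕ) (f : MvPolynomial τ ℂ) :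
    eval (0 : τ → ℂ) (mixedPderiv α f) = (∏ i, ((α i).factorial : ℂ)) * coeff (toF α) f := by
  conv_lhs => rw [f.as_sum, map_sum, map_sum]
  have hterm : ∀ s : τ →₀ ℕ, eval (0 : τ → ℂ) (mixedPderiv α (monomial s (coeff s f))) =
      if s = toF α then (∏ i, ((α i).factorial : ℂ)) * coeff s f else 0 := by
    intro s
    rw [mixedPderiv_monomial, smul_eval, MvPolynomial.eval_zero, constantCoeff_monomial]
    split_ifs with h0 hs hs
    · subst hs
      rw [multiDescFactorial, Nat.cast_prod]
      simp only [toF_apply, Nat.descFactorial_self]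
    · -- `s - α = 0` but `s ≠ α`: then `α ≰ s` and `(s)_α = 0`
      have hαs : ¬ α ≤ ⇑s := fun hle => hs (Finsupp.ext fun i => le_antisymm
        (by have := DFunLike.congr_fun h0 i
            rw [Finsupp.tsub_apply, toF_apply, Finsupp.coe_zero, Pi.zero_apply] at this
            exact Nat.sub_eq_zero_iff_le.1 this) (hle i))
      rw [multiDescFactorial_eq_zero hαs, Nat.cast_zero, zero_mul]
    · exfalso
      exact h0 (by rw [hs]; exact tsub_self _)
    · rw [mul_zero]
  simp only [hterm]
  rw [Finset.sum_ite_eq']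
  split_ifs with hmem
  · rfl
  · rw [notMem_support_iff.1 hmem, mul_zero]

end Mixed

/-! ## §2 The differential polynomial `W(f,g) = Σ_{α ≤ κ} (-1)^{|α|} ∂^α f · ∂^{κ-α} g` -/

section W

/-- **`W_κ(f,g) = Σ_{α ≤ κ} (-1)^{|α|} ∂^α f · ∂^{κ-α} g`**, whose value at `0` is `{f,g}_κ`.
[cite: BorceaBranden2009II, §5 (definition of `{f,g}_κ`)] -/
def apolarW (κ : τ → ℕ) (f g : MvPolynomial τ ℂ) : MvPolynomial τ ℂ :=
  ∑ α ∈ Fintype.piFinset (fun i => range (κ i + 1)),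
    ((-1 : ℂ) ^ (∑ i, α i)) • (mixedPderiv α f * mixedPderiv (κ - α) g)

/-- `W_κ(f,g)(0) = {f,g}_κ`. [cite: BorceaBranden2009II, §5 (definition of `{f,g}_κ`)] -/
theorem eval_zero_apolarW (κ : τ → ℕ) (f g : MvPolynomial τ ℂ) :
    eval (0 : τ → ℂ) (apolarW κ f g) = mvApolarForm κ f g := by
  rw [apolarW, map_sum, mvApolarForm]
  refine Finset.sum_congr rfl fun α _ => ?_
  rw [smul_eval, map_mul, eval_zero_mixedPderiv, eval_zero_mixedPderiv]
  simp only [Nat.cast_mul, Pi.sub_apply, Finset.prod_mul_distrib]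
  ring

/-- `∂^β f = 0` when `β_i` exceeds the degree box of `f`. [cite: BorceaBranden2009II, §5 (`f ∈ ℂ_κ[z]`)] -/
theorem mixedPderiv_eq_zero_of_lt {κ : τ → ℕ} {f : MvPolynomial τ ℂ} (hf : ∀ i, degreeOf i f ≤ κ i)
    {β : τ → ℕ} {i : τ} (h : κ i < β i) : mixedPderiv β f = 0 :=
  mixedPderiv_eq_zero_of_degreeOf_lt ((hf i).trans_lt h)

/-- **`∂_i W_κ(f,g) = 0` for `f, g ∈ ℂ_κ[z]`**: after Leibniz the two sums cancel (shift `α ↦ α + e_i` in the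
first; the boundary terms vanish because `∂^{κ+e_i}`-type derivatives kill `ℂ_κ[z]`).
[cite: BorceaBranden2009II, §5 Lemma 5.4 (invariance of `{·,·}_κ`)] -/
theorem pderiv_apolarW_eq_zero {κ : τ → ℕ} {f g : MvPolynomial τ ℂ} (hf : ∀ i, degreeOf i f ≤ κ i)
    (hg : ∀ i, degreeOf i g ≤ κ i) (i : τ) : pderiv i (apolarW κ f g) = 0 := by
  set box := Fintype.piFinset (fun j => range (κ j + 1)) with hbox
  -- the shifts `α ↦ α ± e_i`
  set up : (τ → ℕ) → (τ → ℕ) := fun α => Function.update α i (α i + 1) with hup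
  set dn : (τ → ℕ) → (τ → ℕ) := fun α => Function.update α i (α i - 1) with hdn
  have hup_i : ∀ α : τ → ℕ, up α i = α i + 1 := fun α => by
    rw [hup]; dsimp only; rw [Function.update_self]
  have hup_ne : ∀ (α : τ → ℕ) {j}, j ≠ i → up α j = α j := fun α j hj => by
    rw [hup]; dsimp only; rw [Function.update_of_ne hj]
  have hdn_i : ∀ α : τ → ℕ, dn α i = α i - 1 := fun α => by
    rw [hdn]; dsimp only; rw [Function.update_self]
  have hdn_ne : ∀ (α : τ → ℕ) {j}, j ≠ i → dn α j = α j := fun α j hj => by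
    rw [hdn]; dsimp only; rw [Function.update_of_ne hj]
  have hsum_up : ∀ α : τ → ℕ, (∑ j, up α j) = (∑ j, α j) + 1 := fun α => by
    rw [← Finset.sum_erase_add _ _ (Finset.mem_univ i),
      ← Finset.sum_erase_add (Finset.univ) α (Finset.mem_univ i), hup_i,
      Finset.sum_congr rfl fun j hj => hup_ne α (Finset.ne_of_mem_erase hj), add_assoc]
  -- Leibniz
  have hL : pderiv i (apolarW κ f g) =
      ∑ α ∈ box, ((-1 : ℂ) ^ (∑ j, α j)) • (mixedPderiv (up α) f * mixedPderiv (κ - α) g) +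
      ∑ α ∈ box, ((-1 : ℂ) ^ (∑ j, α j)) • (mixedPderiv α f * mixedPderiv (up (κ - α)) g) := by
    rw [apolarW, map_sum, ← Finset.sum_add_distrib]
    refine Finset.sum_congr rfl fun α _ => ?_
    rw [Derivation.map_smul, pderiv_mul, pderiv_mixedPderiv, pderiv_mixedPderiv, smul_add]
  rw [hL]
  -- first sum: the terms with `α_i = κ_i` vanish; reindex the rest by `β = α + e_i`
  have h1a : ∀ α ∈ box.filter (fun α => ¬ α i < κ i),
      ((-1 : ℂ) ^ (∑ j, α j)) • (mixedPderiv (up α) f * mixedPderiv (κ - α) g) = 0 := by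
    intro α hα
    have hαi : α i = κ i :=
      le_antisymm (mem_box_iff.1 (Finset.mem_filter.1 hα).1 i) (not_lt.1 (Finset.mem_filter.1 hα).2)
    have hlt : κ i < up α i := by rw [hup_i, hαi]; exact Nat.lt_succ_self _
    rw [mixedPderiv_eq_zero_of_lt hf hlt, zero_mul, smul_zero]
  have h1 : ∑ α ∈ box, ((-1 : ℂ) ^ (∑ j, α j)) • (mixedPderiv (up α) f * mixedPderiv (κ - α) g) =
      ∑ β ∈ box.filter (fun β => 1 ≤ β i),
        -(((-1 : ℂ) ^ (∑ j, β j)) • (mixedPderiv β f * mixedPderiv (up (κ - β)) g)) := by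
    rw [← Finset.sum_filter_add_sum_filter_not box (fun α => α i < κ i), Finset.sum_eq_zero h1a, add_zero]
    refine Finset.sum_nbij' up dn (fun α hα => ?_) (fun β hβ => ?_) (fun α hα => ?_) (fun β hβ => ?_)
      (fun α hα => ?_)
    · have h := Finset.mem_filter.1 (Finset.mem_coe.1 hα)
      refine Finset.mem_coe.2 (Finset.mem_filter.2 ⟨mem_box_iff.2 fun j => ?_, ?_⟩)
      · by_cases hji : j = i
        · subst hji; rw [hup_i]; exact h.2
        · rw [hup_ne α hji]; exact mem_box_iff.1 h.1 j
      · rw [hup_i]; exact Nat.succ_pos _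
    · have h := Finset.mem_filter.1 (Finset.mem_coe.1 hβ)
      refine Finset.mem_coe.2 (Finset.mem_filter.2 ⟨mem_box_iff.2 fun j => ?_, ?_⟩)
      · by_cases hji : j = i
        · subst hji; rw [hdn_i]; exact (Nat.sub_le _ _).trans (mem_box_iff.1 h.1 j)
        · rw [hdn_ne β hji]; exact mem_box_iff.1 h.1 j
      · rw [hdn_i]; exact Nat.sub_one_lt_of_le h.2 (mem_box_iff.1 h.1 i)
    · funext j
      by_cases hji : j = i
      · subst hji; rw [hdn_i, hup_i, Nat.add_sub_cancel]
      · rw [hdn_ne _ hji, hup_ne _ hji]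
    · have h := Finset.mem_filter.1 (Finset.mem_coe.1 hβ)
      funext j
      by_cases hji : j = i
      · subst hji; rw [hup_i, hdn_i, Nat.sub_add_cancel h.2]
      · rw [hup_ne _ hji, hdn_ne _ hji]
    · have h := Finset.mem_filter.1 (Finset.mem_coe.1 hα)
      have hκ : κ - α = up (κ - up α) := by
        funext j
        by_cases hji : j = i
        · subst hji
          rw [hup_i, Pi.sub_apply, Pi.sub_apply, hup_i]
          have := h.2
          omega
        · rw [hup_ne _ hji, Pi.sub_apply, Pi.sub_apply, hup_ne _ hji]
      rw [hsum_up, pow_succ, hκ, mul_neg_one, neg_smul, neg_neg]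
  -- second sum: the terms with `α_i = 0` vanish
  have h2a : ∀ α ∈ box.filter (fun α => ¬ 1 ≤ α i),
      ((-1 : ℂ) ^ (∑ j, α j)) • (mixedPderiv α f * mixedPderiv (up (κ - α)) g) = 0 := by
    intro α hα
    have hαi : α i = 0 := Nat.lt_one_iff.1 (not_le.1 (Finset.mem_filter.1 hα).2)
    have hlt : κ i < up (κ - α) i := by
      rw [hup_i, Pi.sub_apply, hαi, Nat.sub_zero]; exact Nat.lt_succ_self _
    rw [mixedPderiv_eq_zero_of_lt hg hlt, mul_zero, smul_zero]
  have h2 : ∑ α ∈ box, ((-1 : ℂ) ^ (∑ j, α j)) • (mixedPderiv α f * mixedPderiv (up (κ - α)) g) =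
      ∑ β ∈ box.filter (fun β => 1 ≤ β i),
        ((-1 : ℂ) ^ (∑ j, β j)) • (mixedPderiv β f * mixedPderiv (up (κ - β)) g) := by
    rw [← Finset.sum_filter_add_sum_filter_not box (fun α => 1 ≤ α i), Finset.sum_eq_zero h2a, add_zero]
  rw [h1, h2, ← Finset.sum_add_distrib]
  exact Finset.sum_eq_zero fun β _ => neg_add_cancel _

omit [Fintype τ] in
/-- A polynomial all of whose partial derivatives vanish is constant (characteristic `0`).
[cite: BorceaBranden2009II, §5 Lemma 5.4 (invariance)] -/
theorem eq_C_of_forall_pderiv_eq_zero {p : MvPolynomial τ ℂ} (h : ∀ i, pderiv i p = 0) :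
    p = C (coeff 0 p) := by
  ext m
  rw [coeff_C]
  split_ifs with hm
  · rw [← hm]
  · obtain ⟨i, hi⟩ : ∃ i, m i ≠ 0 := by
      by_contra hcon
      push Not at hcon
      exact hm (Finsupp.ext fun i => by rw [hcon i, Finsupp.coe_zero, Pi.zero_apply]).symm
    have key := coeff_pderiv p (m - Finsupp.single i 1) (i := i)
    rw [h i, coeff_zero, show m - Finsupp.single i 1 + Finsupp.single i 1 = m from
      tsub_add_cancel_of_le (Finsupp.single_le_iff.2 (Nat.one_le_iff_ne_zero.2 hi))] at key
    rcases mul_eq_zero.1 key.symm with h0 | h0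
    · exact h0
    · exfalso
      rw [Finsupp.tsub_apply, Finsupp.single_eq_same] at h0
      have : ((m i - 1 : ℕ) : ℂ) + 1 = (m i : ℕ) := by
        rw [← Nat.cast_add_one, Nat.sub_add_cancel (Nat.one_le_iff_ne_zero.2 hi)]
      rw [this] at h0
      exact hi (Nat.cast_eq_zero.1 h0)

/-- **`W_κ(f,g)` is the constant `{f,g}_κ`** for `f, g ∈ ℂ_κ[z]`. [cite: BorceaBranden2009II, §5 Lemma 5.4] -/
theorem apolarW_eq_C {κ : τ → ℕ} {f g : MvPolynomial τ ℂ} (hf : ∀ i, degreeOf i f ≤ κ i)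
    (hg : ∀ i, degreeOf i g ≤ κ i) : apolarW κ f g = C (mvApolarForm κ f g) := by
  have h := eq_C_of_forall_pderiv_eq_zero (pderiv_apolarW_eq_zero hf hg)
  rw [h, ← eval_zero_apolarW κ f g, h, eval_C, coeff_C, if_pos rfl]

end W

/-! ## §3 Translations -/

section Translation

omit [Fintype τ] [DecidableEq τ] in
/-- `Φ(z_j) = a z_j + b` for the affine substitution. [cite: BorceaBranden2009II, §1 Lemma 1.8] -/
theorem affineSubst_X (a b : ℂ) (j : τ) : affineSubst a b (X j : MvPolynomial τ ℂ) = C a * X j + C b := by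
  rw [affineSubst, bind₁_X_right]

omit [Fintype τ] in
/-- **`∂_i` commutes with translations**: `∂_i (f(z + b)) = (∂_i f)(z + b)`. [cite: BorceaBranden2009II, §5
Lemma 5.4 (affine `φ_i`)] -/
theorem pderiv_affineSubst_one (i : τ) (b : ℂ) (f : MvPolynomial τ ℂ) :
    pderiv i (affineSubst 1 b f) = affineSubst 1 b (pderiv i f) := by
  have hX : ∀ j, pderiv i (affineSubst (1 : ℂ) b (X j)) = affineSubst 1 b (pderiv i (X j)) := fun j => by
    rw [affineSubst_X, map_add, pderiv_C, add_zero, pderiv_C_mul, pderiv_X, C_1, one_mul]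
    by_cases hij : i = j
    · subst hij
      rw [Pi.single_eq_same, map_one]
    · rw [Pi.single_eq_of_ne' hij, map_zero]
  induction f using MvPolynomial.induction_on with
  | C a => rw [show affineSubst (1 : ℂ) b (C a) = C a from bind₁_C_right _ _, pderiv_C, map_zero]
  | add p q hp hq => rw [map_add, map_add, hp, hq, map_add, map_add]
  | mul_X p j hp => rw [map_mul, pderiv_mul, hp, hX, pderiv_mul, map_add, map_mul, map_mul]

omit [Fintype τ] in
/-- `∂_i^k` commutes with translations. [cite: BorceaBranden2009II, §5 Lemma 5.4] -/
theorem iterate_pderiv_affineSubst_one (i : τ) (k : ℕ) (b : ℂ) (f : MvPolynomial τ ℂ) :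
    (pderiv i)^[k] (affineSubst 1 b f) = affineSubst 1 b ((pderiv i)^[k] f) := by
  induction k with
  | zero => rfl
  | succ k ih => rw [Function.iterate_succ_apply', Function.iterate_succ_apply', ih, pderiv_affineSubst_one]

/-- **`∂^α` commutes with translations.** [cite: BorceaBranden2009II, §5 Lemma 5.4] -/
theorem mixedPderiv_affineSubst_one (α : τ → ℕ) (b : ℂ) (f : MvPolynomial τ ℂ) :
    mixedPderiv α (affineSubst 1 b f) = affineSubst 1 b (mixedPderiv α f) := by
  suffices h : ∀ l : List τ, (l.map fun i => (pderiv i).toLinearMap ^ α i).prod (affineSubst 1 b f) =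
      affineSubst 1 b ((l.map fun i => (pderiv i).toLinearMap ^ α i).prod f) by
    rw [mixedPderiv]
    exact h _
  intro l
  induction l with
  | nil => rfl
  | cons i l ih =>
    rw [List.map_cons, List.prod_cons, Module.End.mul_apply, Module.End.mul_apply, ih, Module.End.pow_apply,
      Module.End.pow_apply, show ⇑((pderiv i).toLinearMap) = ⇑(pderiv i : Derivation ℂ (MvPolynomial τ ℂ)
        (MvPolynomial τ ℂ)) from rfl, iterate_pderiv_affineSubst_one]

/-- `W_κ` commutes with translations. [cite: BorceaBranden2009II, §5 Lemma 5.4] -/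
theorem apolarW_affineSubst_one (κ : τ → ℕ) (b : ℂ) (f g : MvPolynomial τ ℂ) :
    apolarW κ (affineSubst 1 b f) (affineSubst 1 b g) = affineSubst 1 b (apolarW κ f g) := by
  rw [apolarW, apolarW, map_sum]
  refine Finset.sum_congr rfl fun α _ => ?_
  rw [map_smul, map_mul, mixedPderiv_affineSubst_one, mixedPderiv_affineSubst_one]

/-- **Translation invariance of the apolarity form**: `{f(z+b), g(z+b)}_κ = {f,g}_κ` for `f, g ∈ ℂ_κ[z]`
(Lemma 5.4 with `a_i = d_i = 1`, `c_i = 0`, `b_i = b`). [cite: BorceaBranden2009II, §5 Lemma 5.4] -/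
theorem mvApolarForm_affineSubst_one {κ : τ → ℕ} {f g : MvPolynomial τ ℂ} (hf : ∀ i, degreeOf i f ≤ κ i)
    (hg : ∀ i, degreeOf i g ≤ κ i) (b : ℂ) :
    mvApolarForm κ (affineSubst 1 b f) (affineSubst 1 b g) = mvApolarForm κ f g := by
  rw [← eval_zero_apolarW, apolarW_affineSubst_one, eval_affineSubst, apolarW_eq_C hf hg, eval_C]

end Translation

/-! ## §4 Dilations -/

section Dilation

omit [Fintype τ] [DecidableEq τ] in
/-- `(c z^s)(az) = c a^{|s|} z^s`. [cite: BorceaBranden2009II, §5 Lemma 5.4 (affine `φ_i`)] -/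
theorem affineSubst_zero_monomial (a : ℂ) (s : τ →₀ ℕ) (c : ℂ) :
    affineSubst a 0 (monomial s c) = monomial s (c * a ^ (s.sum fun _ e => e)) := by
  rw [affineSubst, bind₁_monomial, monomial_eq, Finsupp.prod, Finsupp.sum]
  simp only [map_zero, add_zero, mul_pow, ← map_pow, Finset.prod_mul_distrib, ← map_prod,
    Finset.prod_pow_eq_pow_sum, map_mul]
  ring

/-- **Coefficients under dilation**: `[z^m] f(az) = a^{|m|} [z^m] f`. [cite: BorceaBranden2009II, §5
Lemma 5.4] -/
theorem coeff_affineSubst_zero (a : ℂ) (f : MvPolynomial τ ℂ) (m : τ →₀ ℕ) :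
    coeff m (affineSubst a 0 f) = a ^ (∑ i, m i) * coeff m f := by
  induction f using MvPolynomial.induction_on' with
  | monomial s c =>
    rw [affineSubst_zero_monomial, coeff_monomial, coeff_monomial]
    split_ifs with h
    · subst h
      rw [Finsupp.sum_fintype _ _ fun _ => rfl]
      ring
    · rw [mul_zero]
  | add p q hp hq => rw [map_add, coeff_add, coeff_add, hp, hq, mul_add]

/-- **The apolarity form under dilations**: `{f(az), g(az)}_κ = a^{|κ|} {f,g}_κ`.
[cite: BorceaBranden2009II, §5 Lemma 5.4 (with `φ_i(ζ) = aζ`)] -/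
theorem mvApolarForm_affineSubst_zero (κ : τ → ℕ) (a : ℂ) (f g : MvPolynomial τ ℂ) :
    mvApolarForm κ (affineSubst a 0 f) (affineSubst a 0 g) = a ^ (∑ i, κ i) * mvApolarForm κ f g := by
  rw [mvApolarForm, mvApolarForm, Finset.mul_sum]
  refine Finset.sum_congr rfl fun α hα => ?_
  rw [coeff_affineSubst_zero, coeff_affineSubst_zero]
  have hsum : (∑ i, toF α i) + (∑ i, toF (κ - α) i) = ∑ i, κ i := by
    rw [← Finset.sum_add_distrib]
    exact Finset.sum_congr rfl fun i _ => by
      rw [toF_apply, toF_apply, Pi.sub_apply, Nat.add_sub_cancel' (mem_box_iff.1 hα i)]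
  rw [← hsum, pow_add]
  ring

/-- **The apolarity form under `z ↦ az + b`** (`f, g ∈ ℂ_κ[z]`): `{f(az+b), g(az+b)}_κ = a^{|κ|} {f,g}_κ`.
[cite: BorceaBranden2009II, §5 Lemma 5.4 (affine `φ_i`)] -/
theorem mvApolarForm_affineSubst {κ : τ → ℕ} {f g : MvPolynomial τ ℂ} (hf : ∀ i, degreeOf i f ≤ κ i)
    (hg : ∀ i, degreeOf i g ≤ κ i) (a b : ℂ) :
    mvApolarForm κ (affineSubst a b f) (affineSubst a b g) = a ^ (∑ i, κ i) * mvApolarForm κ f g := by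
  have h : ∀ p : MvPolynomial τ ℂ, affineSubst a b p = affineSubst a 0 (affineSubst 1 b p) := fun p => by
    rw [affineSubst_affineSubst, one_mul, one_mul, zero_add]
  rw [h f, h g, mvApolarForm_affineSubst_zero, mvApolarForm_affineSubst_one hf hg]

end Dilation

/-! ## §5 Theorem 5.6 for `C_1 = ⋯ = C_n` an open disc -/

section Ball

/-- **Borcea–Brändén II, Theorem 5.6 for `C_1 = ⋯ = C_n = {|z - c| < r}`** (`r > 0`): if `f ∈ ℂ_κ[z]` has no
zeros in `Cⁿ` and `g`, of degree `κ`, has no zeros in `(ℂ ∖ C)ⁿ`, then `{f,g}_κ ≠ 0`. Proof as printed: the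
affine `Φ` with `Φ(𝔻) = C` transports `f, g` to the situation of Lemma 5.5, and `{Φf, Φg}_κ = r^{|κ|}{f,g}_κ`.
[cite: BorceaBranden2009II, §5 Thm. 5.6 (all `C_i` equal to one disc)] -/
theorem BorceaBranden_apolarity_ball {κ : τ → ℕ} {f g : MvPolynomial τ ℂ} (hf : ∀ i, degreeOf i f ≤ κ i)
    (c : ℂ) {r : ℝ} (hr : 0 < r) (hfs : ∀ z : τ → ℂ, (∀ i, ‖z i - c‖ < r) → eval z f ≠ 0)
    (hg : ∀ i, degreeOf i g = κ i) (hgs : ∀ z : τ → ℂ, (∀ i, r ≤ ‖z i - c‖) → eval z g ≠ 0) :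
    mvApolarForm κ f g ≠ 0 := by
  have hr0 : (r : ℂ) ≠ 0 := Complex.ofReal_ne_zero.2 hr.ne'
  have hF := BorceaBranden_apolarity_disk (κ := κ) (f := affineSubst r c f) (g := affineSubst r c g)
    (fun i => (degreeOf_affineSubst_le _ _ f i).trans (hf i)) (isDiskStable_affineSubst c hr hfs)
    (fun i => by rw [degreeOf_affineSubst hr0, hg i]) (closedExteriorDiskStable_affineSubst c hr hgs)
  rw [mvApolarForm_affineSubst hf (fun i => (hg i).le)] at hF
  exact right_ne_zero_of_mul hF

end Ball

end Literature.Combinatorics.StablePolynomials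

end
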